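import Mathlib
import HarnessLib
import Literature.MathematicalPhysics.StatisticalMechanics.StrongWeightDomination
import Literature.MathematicalPhysics.StatisticalMechanics.WeightDataABKM
import Literature.MathematicalPhysics.StatisticalMechanics.WeightParametersABKM
import Literature.MathematicalPhysics.StatisticalMechanics.TorusBlocks
import Literature.MathematicalPhysics.StatisticalMechanics.RenormalisationMap

/-!
# Lemma 9.3 of [ABKM19] for the CONCRETE strong weight `W_k^B = e^{½ h_k^{−2}(φ, M_k^B φ)}` of the
# torus tower: `‖e^{±H(B)}‖_{k,B} ≤ e^{1/4}`, `‖e^{H(B)} − 1‖_{k,B} ≤ 8e^{1/4}‖H‖_{k,0}` on `‖H‖_{k,0} ≤ ⅛`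

Instantiation of `StrongNormExp` (Lemma 9.3 for an abstract `ℓ²`-dominating weight) with the strong
weight of the [ABKM19] weight tower at scale `k` on a block `B = B_x`:
`strongWeightABKM h L d Mord R k B = expWeight (g_k • derivForm L k (diffIndex d Mord) (χ_k^B))`,
`g_k = h_k^{−2}` (`strongCoef`, `k ≤ N`), `χ_k^B` the box density of `WeightDataABKM` (`≥ 1` on `B`):

* `linIndex_subset_diffIndex` (`⌊d/2⌋ + 1 ≤ M_ord`);
* **`ell2Dominates_strongWeight_abkm`** — `Ell2Dominates B 𝔥_k L^k W_k^B` (the identity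
  `(L^k)² = g_k |B| 𝔥_k²` of the ABKM parameters);
* **`tayNormLE_expNegH_strong_abkm`**, **`tayNormLE_cexp_eval_sub_one_strong_abkm`** — Lemma 9.3.

Everything is proved; no named fact.

## References
* S. Adams, S. Buchholz, R. Kotecký, S. Müller, arXiv:1910.13564, Lemma 9.3, (7.6), (9.14)
  [AdamsBuchholzKoteckyMuller2019].
-/

noncomputable section

namespace Literature.MathematicalPhysics.StatisticalMechanics.GradientRG

open scoped BigOperators
open Finset Matrix
open Literature.MathematicalPhysics.StatisticalMechanics.TorusPolymer
  (IsPolymer blockOf thicken isPolymer_blockOf card_blockOf mem_blockOf_self subset_thicken)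

variable {d M : ℕ} [NeZero M]

/-- `linIndex d ⊆ diffIndex d M_ord` when `⌊d/2⌋ + 1 ≤ M_ord`. [cite: AdamsBuchholzKoteckyMuller2019, Ch. 6.4 (6.40)] -/
theorem linIndex_subset_diffIndex {Mord : ℕ} (hM : d / 2 + 1 ≤ Mord) :
    ∀ α : Fin d → ℕ, α ∈ linIndex d → α ∈ diffIndex d Mord := fun α hα => by
  obtain ⟨h1, h2⟩ := mem_linIndex.1 hα
  exact mem_diffIndex.2 ⟨h1, h2.trans hM⟩

/-- **The strong weight of the torus tower dominates the `ℓ²(B)` level** at scale `k ≤ N` on the block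
`B = B_x` (`L` odd, `M = L^N`, `h > 0`, `⌊d/2⌋ + 1 ≤ M_ord`): `Ell2Dominates B 𝔥_k L^k W_k^B` with
`W_k^B = expWeight (strongCoef h N k • derivForm L k (diffIndex d Mord) (χ_k^B))`.
[cite: AdamsBuchholzKoteckyMuller2019, Lemma 9.3 (9.14)] -/
theorem ell2Dominates_strongWeight_abkm {L N Mord R k : ℕ} {h : ℝ} (hd : 2 ≤ d) (hLodd : Odd L)
    (hM : M = L ^ N) (hk : k ≤ N) (hh : 0 < h) (hMord : d / 2 + 1 ≤ Mord) (x : Fin d → ZMod M) :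
    Ell2Dominates (blockOf (L ^ k) x) (fieldWt h (L : ℝ) d k) ((L : ℝ) ^ k)
      (expWeight (strongCoef h N k • derivForm (L : ℝ) k (diffIndex d Mord)
        (boxDensity (boxRad R L k) (boxWt (L : ℝ) d k) (blockOf (L ^ k) x)))) := by
  have hL0 : (0 : ℝ) < L := by exact_mod_cast hLodd.pos
  obtain ⟨t, ht⟩ : ∃ t, N = k + t := ⟨N - k, by omega⟩
  have hMt : M = L ^ k * L ^ t := by rw [← pow_add, ← ht]; exact hM
  refine ell2Dominates_expWeight_derivForm hL0 (fieldWt_pos hh hL0 d k) k (linIndex_subset_diffIndex hMord)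
    (fun y => boxDensity_nonneg _ (by unfold boxWt; positivity) _ y) ⟨x, mem_blockOf_self _ x⟩
    (fun y hy => one_le_boxDensity_abkm hLodd hM hk (isPolymer_blockOf _ x) (subset_thicken _ _ hy)) ?_
  -- `(L^k)² ≤ g_k |B| 𝔥_k²`, in fact with equality
  rw [card_blockOf hMt hLodd.pow hLodd.pow x, strongCoef_of_le hk]
  push_cast
  have hsq := fieldWt_sq_mul (h := h) hL0 d k
  have hh0 : 0 < hScale h k := hScale_pos hh k
  have hLk : ((L : ℝ) ^ k) ^ d = ((L : ℝ) ^ k) ^ (d - 2) * ((L : ℝ) ^ k) ^ 2 := by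
    rw [← pow_add]; congr 1; omega
  rw [hLk]
  have hid : (hScale h k ^ 2)⁻¹ * ((((L : ℝ) ^ k) ^ (d - 2) * ((L : ℝ) ^ k) ^ 2) * fieldWt h (L : ℝ) d k ^ 2) =
      ((L : ℝ) ^ k) ^ 2 := by
    have e : ((L : ℝ) ^ k) ^ (d - 2) * fieldWt h (L : ℝ) d k ^ 2 = hScale h k ^ 2 := by
      rw [mul_comm]; exact hsq
    calc (hScale h k ^ 2)⁻¹ * ((((L : ℝ) ^ k) ^ (d - 2) * ((L : ℝ) ^ k) ^ 2) * fieldWt h (L : ℝ) d k ^ 2)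
        = (hScale h k ^ 2)⁻¹ * (((L : ℝ) ^ k) ^ (d - 2) * fieldWt h (L : ℝ) d k ^ 2) * ((L : ℝ) ^ k) ^ 2 := by
          ring
      _ = ((L : ℝ) ^ k) ^ 2 := by rw [e, inv_mul_cancel₀ (pow_ne_zero _ hh0.ne'), one_mul]
  rw [hid]

/-- **Lemma 9.3 for the torus tower (Boltzmann factor)**: for `‖H‖_{k,0} ≤ ⅛` (coefficient norm at
`(𝔥_k, L^k, |B|)`), gauge `T = fieldGauge 𝔥_k L^k p S` with `B ⊆ S`, `p ≥ ⌊d/2⌋+1`: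
`‖e^{−H(B)}‖_{T, W_k^B} ≤ e^{1/4}`. [cite: AdamsBuchholzKoteckyMuller2019, Lemma 9.3 (9.15)] -/
theorem tayNormLE_expNegH_strong_abkm {L N Mord R k p : ℕ} {h : ℝ} (hd : 2 ≤ d) (hLodd : Odd L)
    (hM : M = L ^ N) (hk : k ≤ N) (hh : 0 < h) (hMord : d / 2 + 1 ≤ Mord) (hp : d / 2 + 1 ≤ p)
    {x : Fin d → ZMod M} {S : Finset (Fin d → ZMod M)} (hBS : blockOf (L ^ k) x ⊆ S)
    {H : RelevantHamiltonian ℂ d} (r₀ : ℕ)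
    (hH : hamNorm (fieldWt h (L : ℝ) d k) ((L : ℝ) ^ k) (blockOf (L ^ k) x).card H ≤ 1 / 8) :
    TayNormLE (fieldGauge (fieldWt h (L : ℝ) d k) ((L : ℝ) ^ k) p S) r₀
      (expWeight (strongCoef h N k • derivForm (L : ℝ) k (diffIndex d Mord)
        (boxDensity (boxRad R L k) (boxWt (L : ℝ) d k) (blockOf (L ^ k) x))))
      (expNegH H (blockOf (L ^ k) x)) (Real.exp (1 / 4)) := by
  have hL0 : (0 : ℝ) < L := by exact_mod_cast hLodd.pos
  exact tayNormLE_cexp_neg_eval (fieldWt_pos hh hL0 d k) (by positivity) hp hBS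
    (ell2Dominates_strongWeight_abkm (R := R) hd hLodd hM hk hh hMord x) r₀ hH

/-- **Lemma 9.3 for the torus tower (`e^{H} − 1`)**: `‖e^{H(B)} − 1‖_{T, W_k^B} ≤ 8e^{1/4}‖H‖_{k,0}` for
`‖H‖_{k,0} ≤ ⅛`. [cite: AdamsBuchholzKoteckyMuller2019, Lemma 9.3 (9.16)] -/
theorem tayNormLE_cexp_eval_sub_one_strong_abkm {L N Mord R k p : ℕ} {h : ℝ} (hd : 2 ≤ d)
    (hLodd : Odd L) (hM : M = L ^ N) (hk : k ≤ N) (hh : 0 < h) (hMord : d / 2 + 1 ≤ Mord)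
    (hp : d / 2 + 1 ≤ p) {x : Fin d → ZMod M} {S : Finset (Fin d → ZMod M)}
    (hBS : blockOf (L ^ k) x ⊆ S) {H : RelevantHamiltonian ℂ d} (r₀ : ℕ)
    (hH : hamNorm (fieldWt h (L : ℝ) d k) ((L : ℝ) ^ k) (blockOf (L ^ k) x).card H ≤ 1 / 8) :
    TayNormLE (fieldGauge (fieldWt h (L : ℝ) d k) ((L : ℝ) ^ k) p S) r₀
      (expWeight (strongCoef h N k • derivForm (L : ℝ) k (diffIndex d Mord)
        (boxDensity (boxRad R L k) (boxWt (L : ℝ) d k) (blockOf (L ^ k) x))))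
      (fun ψ : (Fin d → ZMod M) → ℝ => Complex.exp (eval H (blockOf (L ^ k) x) ψ) - 1)
      (8 * Real.exp (1 / 4) * hamNorm (fieldWt h (L : ℝ) d k) ((L : ℝ) ^ k) (blockOf (L ^ k) x).card H) := by
  have hL0 : (0 : ℝ) < L := by exact_mod_cast hLodd.pos
  exact tayNormLE_cexp_eval_sub_one (fieldWt_pos hh hL0 d k) (by positivity) hp hBS
    (ell2Dominates_strongWeight_abkm (R := R) hd hLodd hM hk hh hMord x) r₀ hH

end Literature.MathematicalPhysics.StatisticalMechanics.GradientRG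

end
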